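import Summits.ResolutionOfSingularities.ResolutionOfSingularities.Theorems.CylinderCutCells
import Literature.AlgebraicGeometry.Resolution.HironakaTauScheme
import Literature.AlgebraicGeometry.Resolution.BlowupSequences
import Literature.AlgebraicGeometry.Resolution.MarkedIdeals
import Literature.AlgebraicGeometry.Resolution.StalkSpecializesLocalization
import Mathlib.Algebra.CharP.Defs
import Mathlib.Algebra.CharP.Lemmas
import Mathlib.Data.Nat.Multiplicity
import Mathlib.AlgebraicGeometry.Morphisms.Smooth
import HarnessLib

/-!
# SpreadCutLaw — decomp-res node «SpreadCut» (lens-2 g19), file 1/4 of `SpreadCutLaw`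

[WRITER NOTE (decomp-res writer g10).  Content VERBATIM from the decomp-res lens-2 g19 node
`HOME/decomp-res-lens-2/g19/SpreadCut.lean` (pin b2959d31, 3 579 l; HOME = run/shared/lean/pub/decomp-res);
CRITIC-LEDGER row 155 (DECIDED-MOD-PORT +1); landing orders INBOX :540: l. 143–2878 are `CylinderCut` d60dded1
VERBATIM (landed as `CylinderCutClasses` · `CylinderCutCells` ·
`MaxContactCutCylinderCut`) and are DELETED here with the landed modules imported instead (namespaces
`…Theorems.PinchCut` / `JetCut` / `PurityCut` / `SplitCut` / `CylinderCut`
opened; same short names, byte-identical bodies — never two copies); NEW = §Γ (l. 2880–3336, the ring-level law +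
§Γ.3 point level) and §V (l. 3338–3576, the spread cut).
Namespace `…Theorems.SpreadCut` (the lens's `Theses.SpreadCut` is gate-reserved), sub-namespace `Spread` as in the
lens; file split only (tree files ≤ 400 lines): sections,
variables, the `open MvPolynomial` lines and every declaration exactly as in the lens; the node's global
dupNamespace-linter line dropped.  Node files, in import order:
`SpreadCutLaw` (§Γ + the cone-free head of §V; continued `…2` / `…3` where the cap cuts) · `SpreadCutCells` (§V2–§V4
cone-free: the aside home) · the wiring `MaxContactCutSpreadCut`
(§V BY NAME on the host route, in the Theses cone).  All `--supports stmt-ResolutionOfSingularities-29273`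
(`MaxContactCut.RungOne`); nothing closes 29273 — decided halves
carry their engines as hypotheses (`SpreadExit` is a paper engine, not an item); exactly ONE located-residual aside
on the lens-2 column (`Spread.SpreadSpecialRung`, home
`SpreadCutCells`) SUPERSEDES g18's `Cyl.CylSpecialRung`, re-located EXACTLY modulo the spread decided half.  The
lens header is kept verbatim below.]

# SpreadCut — LAW (Γ): THE SECONDARY CURVE OF THE TOP CURVE (critic window g19, CRITIC-LEDGER row 150 (E*) — «a LAW
deciding a typed
class containing the CERTIFIED JUMP POINT of the slice type (INSEP-v's core, ν = 1 → 5): the generic exit and the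
hand-over at the jump
decided together, EXACT re-location of `Cyl.CylSpecialRung`, inhabitants on both sides»): the STRUCTURAL DICHOTOMY
«the secondary curve
`Γ = V(Φ̄) ⊂ ℙ¹_{𝒪_C}` is REGULAR ∨ it is SINGULAR».  Along a regular top curve `C` of order `n` whose `C`-relative
δ-face, in the regime
`m + 1 = (q+1)n`, is a binary form `Φ` of degree `m` in the two transversal parameters WITH COEFFICIENTS IN
`𝒪_{Y,y}` (the face read over
the discrete valuation ring `𝒪_{C,y}`, NOT over `k(y)`), the law asks that the closed subscheme `V(Φ̄) ⊂ ℙ¹_{𝒪_{C,y}}` — the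
SECONDARY CURVE — be regular at its points over `y` (class (Γ), `IsSpreadAt`; typed chart by chart in the grammar of
g15's `SideClean`).
ENGINE (Γ) `SpreadExit` is DECIDED on paper (§Γ.1): the package is the tower `C, Σ₁, …, Σ_{q−1}` of `ℙ¹`-bundle
sections dictated by the
slope, after which the top locus over `C` lies on `Γ` and the regularity of `Γ` makes `(z_q, u, F̃)` regular
parameters, so the initial
form `B(Z, U) + U^{n−1}L` is IRREDUCIBLE and `τ ≥ 3` at EVERY top point over `C` — at the generic fibres (simple
roots: the generic exit)
AND at the jump points (multiple roots moving transversally: `Γ` ramifies over `C`, the directrix picks up the curve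
direction `V`) by ONE
letter.  The located residual `Cyl.CylSpecialRung` of g18 is RE-LOCATED EXACTLY (0 sorry) as
`Spread.SpreadSpecialRung`, losing the
certified jump point INSEP-v = `(z + vU)² + u₁⁵ + v·u₂⁵ + u₂⁷ /𝔽₂` (secondary curve `w⁵ + v̄ = 0`: regular, totally
ramified of index 5)
and keeping the certified INSEP-v³ = `(z + vU)² + u₁⁵ + v³·u₂⁵ + u₂⁷` (secondary curve `w⁵ + v̄³ = 0`: the
`(3,5)`-CUSP — frame-free by
the canonical tower, NODE-g19 §4; the letter fails PROVABLY in the natural frame: kernel `not_relSimple_X_pow_add_C_of_mem_sq`)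
(decomp-res lens-2 «structural dichotomy (special vs generic)», g19)

ROOT DECOMPOSITION CELL `decomp-res`, RESIDUAL MODE (D-0179), generation 19.  TARGET (tree item, BY NAME):
`MaxContactCut.RungOne`
(stmt-ResolutionOfSingularities-29273, `E 2 → E 1`); LOCATED RESIDUAL CUT: g18's `Cyl.CylSpecialRung` (class `IsCylSpecialPt`),
restated verbatim-in-body here (§R18 = the whole body of `g18/CylinderCut.lean`, sha256 d60dded1…, lines 124–2859,
byte-identical;
g18 itself restates g14–g17) because g14–g18 live as HOME files only and a HOME file cannot be imported by a farm
check.  This file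
IMPORTS exactly g18's 27 tree / Mathlib modules.  New content: §Γ (the secondary-curve law, its engine, ring
kernels, the inhabitants'
presentations), §V (the spread cut).  0 `sorry`, 0 new axioms; `lean check` rc 0.

## §1  CRITIC WINDOW g19 (CRITIC-LEDGER row 150; standard cn27) — what is priced and how this file answers

Priced 0 (cylinder family CLOSED): étale / Nisnevich / henselian / formal re-typings of (Cyl)/(JCyl), sharper jet
moduli, moving frames,
base `S` of dimension `≤ 2`, `I = (f) + I′` variants, and (E-gen) equiresolution over an open `C°` by transport.
Priced +1 (one of):
(E*) a LAW deciding a typed class containing a CERTIFIED JUMP POINT of the slice type (INSEP-v's core) — the generic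
exit AND the hand-over
at the jump decided together, EXACT re-location of `Cyl.CylSpecialRung`, inhabitants on both sides; (iii)
non-principal `I_y` by a law;
(iv) Tangle/Sing/Iso engine.  THIS FILE takes (E*).  It is NOT a cylinder re-typing and NOT equiresolution: no
projection `π`, no base
`S`, no jets, no transport.  WHY IT IS A LAW AND WHY IT IS NEW: every δ-law of the lineage (g11–g13 and their
thresholds G1/G2/G3,
G1ʳ/G2ʳ/G3ʳ) reduces the transversal face through `𝒪_{Y,y} → k(y)` and therefore sees, at INSEP-v's core, the
five-fold root `ū₁⁵` and
nothing else (NODE-g18 §4: every threshold fails); the cone / ladder / split laws (M)(C)(J)(T)(L)(L′)(D)(D⁺)(S) need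
a readable cone,
which the pure square `(z + vU)²` does not have (LEMMA Q_C); (Cyl)/(JCyl) need the slice type to be CONSTANT along
`C`, and it jumps.
LAW (Γ) reads the face over the discrete valuation ring `A = 𝒪_{C,y}` — one more coefficient ring, no new frame —
and the datum it
decides by is a SCHEME, the secondary curve `V(Φ̄) ⊂ ℙ¹_A`, and one property, REGULARITY.  The `v`-dependence that was the
obstruction for g18 («genuinely `v`-dependent») becomes the resource: `∂_{v̄}Φ̄ ≠ 0` at the multiple root is exactly
what makes `V(Φ̄)`
regular there.  The slice-invariant jump ν = 5 → 1 of the window IS the ramification of the regular curve `V(w⁵ +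
v̄)` over `C`, and the
exit package of the generic slices (`C`, `Σ₁`, then five `τ = 3` points) SPREADS over the core as (`C`, `Σ₁`, then
the single `τ = 3` point
`x₀` with `in₂ f₂ = Z² + U·V`) — a RAMIFIED SPREAD, decided by the same letter at every point of `C`.

## §2  THE LAW, THE ENGINE, THE PAPER PROOF, THE KERNELS — see the §Γ docstring below (§Γ.1 the tower (a)(b)(c),
stage `q`, the key
step «regular secondary curve ⇒ `(z_q, u, F̃)` regular parameters ⇒ `in_n f_q = B(Z,U) + U^{n−1}L` irreducible ⇒ `τ
≥ 3`», closed and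
non-closed points, the hand-over; §Γ.2 the kernels).  Ports NAMED: port L only (blow-up charts of regular centres
and regularity of the
blow-up, Hartshorne II 8.24 / CossartJannsenSaito2020 Ch. 2; controlled transform computed monomially; closedness of `{ord ≥ n}`
(semicontinuity); `gr` of a regular local ring is a polynomial ring; `τ` = dimension of the directrix; blow-ups
commute with the flat base
change `Spec 𝒪_{Y,y} → Y`, StacksProject Tag 0805; properness of `ℙ¹_A`; Serre: localisations of regular local rings
are regular) —
the same named ingredients as the tree engine (U) of g12 and (S) of g17; NO threefold port, NO X1.  SCOPE: `m ≡ −1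
(mod n)` only; the
regime `n ∣ m` is REFUTED as an exit law by a hand counterexample in characteristic `2` (§Γ.1 SCOPE, NODE-g19 §2), the regimes
`1 ≤ m mod n ≤ n − 2` are left to the residual (expected to exit by order; not claimed).

## §3  THE INHABITANTS (hand evidence NODE-g19 §3/§4; ring certificates §Γ.2).  INSEP-v (g18's certified cyl-special point) ∈
`IsSpreadCurvePt` at EVERY point of `C = V(z′, u₁, u₂)`, `z′ = z + v(u₁+u₂)`: `n = 2`, `m = 5`, `q = 2`, `Φ = u₁⁵ + v·u₂⁵`
(`pureCoeff v 5`), `g = u₂⁷ ∈ Q(11)`, `I = (f) ⊆ Q(10)`; at the core `φ₁ = X⁵ + v` passes the letter by the KERNEL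
`relSimple_X_pow_add_C`
(`v ∈ 𝔪 ∖ (𝔪² + 𝔭)`), `φ₂ = vX⁵ + 1` vacuously (`relSimple_of_sub_one_mem`); at `y′ = (π(v))`, `π ≠ v`, `v` is a
unit and `X⁵ + v̄`,
`v̄X⁵ + 1` are separable over `k(y′)` (simple roots); Top-isolated (`Top(I, 2) = C` globally), `IsCurvePt`.  Charts: `f₁ = z₁² +
u³(w⁵ + v + u²)`, `f₂ = z₂² + u(w⁵ + v + u²)`, `Γ = V(z₂, u, w⁵ + v + u²)` regular, over the core the single point `x₀` with
`in₂ f₂ = Z² + UV`, `τ = 3`.  INSEP-v³ ∈ `IsSpreadSpecialPt`: `Top(I,2) = C` (`∂_v f = v²u₂⁵`, `∂_{u₁} = u₁⁴`,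
`∂_{u₂} = u₂⁴(v³ + u₂²)`),
cyl-special verbatim by g18's LEMMA Q_C / §3(c) (they read only `in_𝔭² f = z̄′²`, `f ≡ z′² mod 𝔭⁵`, the bottom layer
`ℓ̄₁⁵` of the
weight-`5b` part, and the slice invariant: ν = 1 at the core, 5 at `v₀ ≠ 0` since `b⁵ + v₀³c⁵` is separable), and
NOT a spread-curve point for
ANY frame by the CANONICAL TOWER INVARIANT (NODE-g19 §4, LEMMA Q_Γ): the engine's centres and conclusions are
intrinsic — membership with
slope parameter `q′` forces `Top(I₁,2) ∩ π⁻¹(y)` finite if `q′ = 1`, every order-2 point of `Y₂` over `y` to have `τ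
≥ 3` if `q′ = 2`, and
`Top(I₂,2) ∩ π⁻¹(y)` to be a LINE if `q′ ≥ 3`; for INSEP-v³ the intrinsic tower has `Top(I₁,2) ∩ π⁻¹(y)` = the line `{z̄₁ = 0}`,
`Top(I₂,2) ∩ π⁻¹(y)` = the single point `x₀` with `f₂ = z₂² + u(w⁵ + v³ + u²)`, `in₂ = Z₂²`, `τ(x₀) = 1` — all three
excluded.  In the natural
frame the letter fails PROVABLY: `a = v³ ∈ 𝔪²`, kernel `not_relSimple_X_pow_add_C_of_mem_sq`.  Honest cofinality:
the residual is inhabited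
and certified.  (INSEP-vv = `… + v²·u₂⁵ + …` is NOT used: in characteristic 2 its `∂_v` vanishes and a SECOND top curve
`V(z + v², u₁, u₂ + v)` crosses `C` at the core — a Tangle-type point, residual for a different reason; NODE-g19 §7.)

## §4  PIECES, TAGS, EDGES (BY NAME) — NODE-g19.md §5.  `MaxContactCut.RungOne ⟸ Spread.SpreadGenericRung [WEAKER ·
DECIDED-MOD-PORT(M+):
`Spread.spreadGenericRung_of_ports` from the engines (V)(Δ)(U)(R)(N) (tree, decided), (M)(C) g14, (G) g16, (S) g17,
(JCyl) g18, the
tree aside 30081 (X1, booked port, for (Cyl)), (Γ) NEW DECIDED, g12's `CurvePackagePort` (COSTUME M+),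
`OrderOneContact` (tree port)]
∧ Spread.SpreadSpecialRung [WEAKER BY LETTER than `Cyl.CylSpecialRung` · UNDECIDED · IDEA-NEEDED · cofinal]`; `Spread.closes`;
`Spread.rungOne_iff` (EXACT); `Spread.cylSpecialRung_iff_spreadSpecialRung` (EXACT RE-LOCATION of the named
residual); INSEP-v ∈ (Γ) ∖
(all earlier classes) (g18 NODE §3(c) + NODE-g19 §3); INSEP-v³ ∈ residual (LEMMA Q_Γ).

## §5  WHAT IS LEFT (located, booked — NODE-g19.md §7): SINGULAR secondary curves (INSEP-v³: the cusp `w⁵ + v̄³ =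
0`; cheapest falsifier
of over-reach: INSEP-v³ is NOT in (Γ) for ANY frame, LEMMA Q_Γ), the slopes `m ≡ ρ (mod n)` with `0 ≤ ρ ≤ n − 2` (`ρ
= 0` in characteristic
`p = n` genuinely different: the hand counterexample of §Γ.1), faces with mixed monomials / non-binary-pure
equisingular families
(`(z+vU)² + u₁⁵ + u₂⁷ + v·u₁³u₂³`), deep splits `z(z + v²U)`, NON-PRINCIPAL `I_y` beyond the δ-deep letter (iii),
Tangle (`R1-notail`),
Sing / Iso (iv).  The residual is «the secondary curve is a SINGULAR plane curve germ in the regular surface `Σ_q ≅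
ℙ¹_C`»: the next law
must resolve `Γ ⊂ Σ_q` by POINT blow-ups of the threefold tower (embedded resolution of a curve in a surface,
carried along) — NEXT-g20.md.

## This file

§Γ (NEW, g19): LAW (Γ) — THE SECONDARY CURVE OF THE TOP CURVE read over `𝒪_C`, ring level: `binForm`, `lowerChart` /
`upperChart`, `RelSimple`, `SpreadShape` + kernels and the INSEP-v certificates (needs the tree's
`DeltaFaceCutClasses.qWeighted`); §Γ.3 point / curve level: `IsSpreadAt`, `IsUniformSpreadCurve`, the ENGINE `def
SpreadExit : Prop` (a paper engine: hypothesis, not an item), `IsSpreadCurvePt`, the decided class; and the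
cone-free head of §V (`spreadLeaf = cylLeaf ∨ (Γ)` + order lemmas, the located residual class `IsSpreadSpecialPt` +
iffs).  PROVED kernels, VERBATIM; continued `…2` where the 400-line cap cuts.

Part 1/4 carries: `binForm`.

(Sources: Hironaka1964 Ch. III; CossartJannsenSaito2020 Ch. 2, Ch. 8–9; CossartPiltant2008 Prop. 4.2;
CossartPiltant2019 Rem. 3.2; BierstoneGrigorievMilmanWlodarczyk2011 §3.1; Moh1987; Hauser2010Kangaroo; Giraud1975;
Narasimhan1983.)
-/

open CategoryTheory AlgebraicGeometry TopologicalSpace IsLocalRing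
open Literature.AlgebraicGeometry.Resolution
open Summit.ResolutionOfSingularities.ResolutionOfSingularities.Theorems
open Summit.ResolutionOfSingularities.ResolutionOfSingularities.Theorems.WeakOrderReduction
open Summit.ResolutionOfSingularities.ResolutionOfSingularities.Theorems.DeltaFaceCutClasses
open Summit.ResolutionOfSingularities.ResolutionOfSingularities.Theorems.RelativeDeltaCut
open Summit.ResolutionOfSingularities.ResolutionOfSingularities.Theorems.CurveLeafExit
open Summit.ResolutionOfSingularities.ResolutionOfSingularities.Theorems.PinchCut
open Summit.ResolutionOfSingularities.ResolutionOfSingularities.Theorems.JetCut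
open Summit.ResolutionOfSingularities.ResolutionOfSingularities.Theorems.PurityCut
open Summit.ResolutionOfSingularities.ResolutionOfSingularities.Theorems.SplitCut
open Summit.ResolutionOfSingularities.ResolutionOfSingularities.Theorems.CylinderCut
open MvPolynomial

namespace Summit.ResolutionOfSingularities.ResolutionOfSingularities.Theorems.SpreadCut

section SpreadRing

variable {R : Type} [CommRing R]

/-! ## §Γ  NEW (g19): LAW (Γ) — THE SECONDARY CURVE OF THE TOP CURVE, read over `𝒪_C` (critic window g19, CRITIC-LEDGER row 150
(E*): «a LAW deciding a typed class containing the CERTIFIED JUMP POINT of the slice type — INSEP-v's core, ν = 1 → 5 — with the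
generic exit AND the hand-over at the jump decided together, EXACT re-location of `Cyl.CylSpecialRung`, inhabitants
on both sides»).

THE STRUCTURAL DICHOTOMY of this generation (lens «special vs generic»).  Along a regular top curve `C = closure
{η}` of order `n`
write, at a closed point `y ∈ C` with curve frame `c = (z, u₁, u₂)` (`(c) = 𝔭 = curvePrime`, `(c, v) = 𝔪_y`,
`spanFinrank 𝔪_y = 4`),
a member `f = zⁿ + Φ(u₁, u₂) + g ∈ I_y` whose `C`-RELATIVE δ-FACE is a BINARY FORM `Φ = Σ_{i ≤ m} G_i u₁^i u₂^{m−i}`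
of degree `m`
with coefficients `G_i ∈ 𝒪_{Y,y}` — NOT reduced to the residue field — the tail `g` lying strictly above the face
(`g ∈ Q(mn + 1)`, `Q(λ) = qWeighted c m n λ` = the tree's monomial valuation ideals of weight `z ↦ m`, `u_j ↦ n`)
and the whole ideal
δ-deep (`I_y ⊆ Q(mn)`, the tree's admissibility clause of `HasDeltaFace`), in the arithmetic regime `m + 1 = (q + 1)·n`, `q ≥ 1`
(`δ = m/n = q + (n−1)/n`: the LAST admissible slope before an integer; for `n = 2` every odd `m ≥ 3`; `gcd(m, n) =
1`, so the face
carries no mixed monomial `zⁱuᵅ`, `0 < i < n`).  Every δ-law of the lineage (g11 `IsDeltaGenericAt`, g12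
`IsRelDeltaGenericAt`, g13,
and their thresholds G1/G2/G3) reads the face THROUGH `𝒪_{Y,y} → k(y)`, where `v ↦ 0`: for INSEP-v = `(z+vU)² + u₁⁵
+ v·u₂⁵ + u₂⁷` the
residue face is `ū₁⁵`, a five-fold root, and every threshold fails (NODE-g18 §4).  LAW (Γ) reads the face OVER THE
DISCRETE VALUATION
RING `A := 𝒪_{Y,y}/𝔭 = 𝒪_{C,y}` (uniformiser `v̄`): the image `Φ̄ ∈ A[U₁, U₂]_m` defines a closed subscheme
            `Γ_y := V(Φ̄) ⊂ ℙ¹_A`            — THE SECONDARY CURVE of `C` at `y` —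
and the class asks exactly: **`Γ_y` is REGULAR at its points over `y`** (typed chart by chart as `RelSimple 𝔭 𝔪_y φ₁` and
`RelSimple 𝔭 𝔪_y φ₂` for the two dehomogenisations `φ₁ = Σ G_i Xⁱ = Φ(X, 1)`, `φ₂ = Σ G_i X^{m−i} = Φ(1, X)` in
`𝒪_{Y,y}[X]`: for every
maximal `𝔑 ⊇ 𝔪_y·𝒪_{Y,y}[X]` containing `φ`, `φ ∉ 𝔑² + 𝔭·𝒪_{Y,y}[X]` — the same grammar as g15's `SideClean`, read
on a different
polynomial).  Unfolded: the residue form `Φ̿ := Φ̄ mod v̄ ∈ k(y)[U₁,U₂]_m` is NON-ZERO, and at every MULTIPLE zero `ξ` of `Φ̿` on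
`ℙ¹_{k(y)}` the `v̄`-linear part of `Φ̄` does not vanish at `ξ` — «multiple roots of the slice face move transversally at unit
speed».  Where `Φ̿` is squarefree this is the simple-root situation of g12 read over `A`; the NEW members are the
JUMP POINTS: at the
core of INSEP-v, `Φ̄ = U₁⁵ + v̄·U₂⁵`, `Φ̿ = U₁⁵` (five-fold root), `∂_{v̄}Φ̄ = U₂⁵ ≠ 0` there, and `Γ_y = V(w⁵ + v̄)
⊂ 𝔸¹_A` is a REGULAR
curve, TOTALLY RAMIFIED of index 5 over `C` at `y`: the five simple roots of the slices `v = v₀ ≠ 0` (slice invariant ν = 5)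
coalesce to one (ν = 1) — the slice-type jump of the window IS the ramification of the regular secondary curve.  The residual
(`IsSpreadSpecialPt`) is where `Γ_y` is SINGULAR for every frame: INSEP-v³ = `(z+vU)² + u₁⁵ + v³·u₂⁵ + u₂⁷` (`Γ_y =
V(w⁵ + v̄³)`,
the `(3,5)`-cusp; certified frame-free by the canonical tower, NODE-g19 §4; in the natural frame the letter fails
PROVABLY, kernel
`not_relSimple_X_pow_add_C_of_mem_sq`).

### §Γ.1  ENGINE (Γ) `SpreadExit` — DECIDED (paper proof; every step a chart identity below or a named port-L ingredient)
Data: `Y` regular, `I`, `n ≥ 2`, `η` a curve point (`C := {y | η ⤳ y}`: `η` and closed points), `m` with `m + 1 = (q+1)n`, `q ≥ 1`,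
and at EVERY closed `y ∈ C` letters `(c, v, G, g, f)` as above (`IsUniformSpreadCurve I n m η`).  Fix a closed `y`, `R := 𝒪_{Y,y}`
(regular local, `dim R = embdim R = 4`), `𝔭 = (z, u₁, u₂)` (a prime generated by part of a regular system, height
3), `A = R/𝔭` a DVR
with uniformiser `v̄`.  WEIGHTS: `W(zⁱu^α) := m·i + n·|α|`; `Q(λ)` = the ideal of the monomials of weight `≥ λ`.  Every element of `I_y`
is an `R`-combination of monomials of weight `≥ mn` (letter `I_y ⊆ Q(mn)`); `f = zⁿ + Φ + g`, `W ≡ mn` on `zⁿ` and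
on `Φ`, `W ≥ mn + 1`
on `g`.  (Consequently `I_y ⊆ 𝔪_yⁿ` and `I_𝔭 ⊆ 𝔭ⁿR_𝔭` — a monomial of weight `≥ mn` with `i < n` has `|α| ≥ m(n−i)/n
≥ n − i` since
`m ≥ n` — with equality of orders by the letter `zⁿ`: `ord_y I = ord_η I = n`.)
THE TOWER (local model over `Spec R`; blow-ups commute with the flat base change `Spec 𝒪_{Y,y} → Y`, StacksProject
Tag 0805, so the
model computes the local rings, orders and `τ` of the global tower at every point over `Spec R`).  Stage 0 → 1: blow
up `C = V(z, u₁, u₂)`.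
`z`-chart (`u_j = z·a_j`): a monomial of weight `≥ mn` becomes `z^{i+|α|−n}·a^α` after the controlled division by `zⁿ`, and
`i + |α| − n ≥ 1` unless `(i, α) = (n, 0)` (for `i < n`: `|α| ≥ m(n−i)/n > n − i`; for `i ≥ n`, `α ≠ 0`: clear): the controlled
transform of `f` is `1 + z·(…)`, a UNIT along the exceptional divisor — no point of positive order there.  `u₂`-chart (`u := u₂`,
`u₁ = w·u`, `z = z₁·u`): `zⁱu₁^{α₁}u₂^{α₂} ↦ z₁ⁱ w^{α₁} u^{e₁}`, `e₁ = i + |α| − n`, and `Φ(wu, u) = u^m·φ₁(w)`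
(kernel `binForm_lower`), so
`f₁ = z₁ⁿ + u^{m−n}·φ₁(w) + g₁`; the `u₁`-chart is the mirror image with `w' = u₂/u₁` and `φ₂` (kernel
`binForm_upper`).  Stage `j → j+1`
(`1 ≤ j ≤ q − 1`): blow up `Σ_j := V(z_j, u)` (codimension 2; two charts).  By induction the `u`-charts carry coordinates `(z_j, w, u, v)`
with `z = z_j u^j`, `u₁ = wu`, `u₂ = u`, and a monomial of `f` (or of any `h ∈ I_y`) has become `z_jⁱ w^{α₁} u^{e_j}`,
            `e_j(i, α) = |α| + j·(i − n)`,            controlled transform `h_j = Σ coeff · z_jⁱ w^{α₁} u^{e_j}`.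
(a) `z_j`-charts are EMPTY of order: in the `z_j`-chart of the blow-up of `Σ_j` (`u = z_j·ũ`) the monomial becomes
`z_j^{a}·w^{α₁}ũ^{e_j}`
with `a = i + e_j − n = (j+1)(i − n) + |α|`, and `a ≥ 1` for every monomial of weight `≥ mn` other than `zⁿ` as long
as `j ≤ q − 1`
(for `i < n`: `a ≥ (n − i)(m/n − (j+1)) ≥ (n−i)(m/n − q) = (n−i)(n−1)/n > 0`; for `i ≥ n`: clear); `zⁿ ↦ 1`.  So
`f_{j+1} = 1 + z_j(…)` is a
unit along the new exceptional divisor in that chart.  (b) ORDER ALONG `Σ_j` (`j ≤ q − 1`): the same number `a = i +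
e_j − n ≥ 0` is the
excess of the `(z_j, u)`-order of the term `z_jⁱ w^{α₁} u^{e_j}` over `n`; hence `h_j ∈ (z_j, u)ⁿ` for EVERY `h ∈
I_y`: `Σ_j ⊆ Supp(I_j, n)`
— PERMISSIBLE (weak admissibility needs no more; `Σ_j` is regular: `V(z_j, u)` in a regular chart, globally the
`ℙ¹`-bundle `≅ Σ₁ =
{z̄ = 0} ⊂ ℙ(N_C)` over `C`).  (c) LOCATION (`1 ≤ j ≤ q`): over `C` and off `Σ_j` every point has order `0` (in the
`u`-chart at `x` with
`u(x) = 0 ≠ z_j(x) = a`: `f_j(x) = aⁿ`, all other terms being divisible by `u` — a term with `e_j = 0` would need `W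
≥ mn + 1` with
`|α| = j(n−i)`, i.e. `(n−i)(nj − m) ≥ 1`, impossible for `j ≤ q < m/n`; `z`-charts by (a)); ON `Σ_j` (`j ≤ q−1`) the
order is EXACTLY `n`
(`in_n f_j = Z_jⁿ + U·(…) ≠ 0` in the polynomial ring `gr 𝒪_x`).  Hence `Top(I_j, n) ∩ π_j⁻¹(C) = Σ_j` EXACTLY for
`1 ≤ j ≤ q − 1`: the
centres are INTRINSIC (the local models at different closed points `y, y′ ∈ C` glue, exactly as in the tree engine
(U), g12 (2r)) and
CLOSED (semicontinuity of order on regular schemes — port L, as in every engine of the lineage).  The package is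
            `s := (C; Σ₁; …; Σ_{q−1})`   (length `q`; for `q = 1` just `C`),
weakly admissible for `(I, ∅, n)`, all centres over `C` (`CentresOver`), `s.top = Y_q` regular (blow-ups of regular
schemes in regular
centres: Hartshorne II 8.24 / CossartJannsenSaito2020 Ch. 2).
STAGE `q` (`m − qn = n − 1`).  In the `u₂`-branch `f_q = z_qⁿ + u^{n−1}·F̃ + z_q·K`, where `F̃ := φ₁(w) + u·H₀` collects the terms with
`i = 0` (for them `e_q ≥ n`: from `W ≥ mn + 1`, `i + e_q = (q+1)i + |α| − qn ≥ n − 1 + (i+1)/n`, so `i + e_q ≥ n`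
for EVERY tail term and
`e_q ≥ n` when `i = 0`) and `K ∈ (z_q, u)^{n−1}` the tail terms with `i ≥ 1`.  Let `x ∈ Y_q` lie over `C` with
`ord_x I_q = n`.  By (a)/(c),
`x ∈ Σ_q = V(z_q, u)` (in one of the two branches), and `𝒪_{Σ_q} = 𝒪_{U_q}/(z_q, u) = A[w]` over `Spec A` (`Σ_q ≅ Σ₁
≅ ℙ¹_C`, chart
`𝔸¹_A = Spec A[w]`; `F̃ ↦ φ̄₁`).  Since `u` is a regular parameter at `x` and `gr 𝒪_x` is a domain,
`ord_x(u^{n−1}F̃) = n − 1 + ord_x F̃`,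
so `ord_x f_q ≥ n ⟺ F̃ ∈ 𝔪_x ⟺ φ̄₁ ∈ 𝔔_x` (`𝔔_x ⊂ A[w]` the prime of `x̄ ∈ Σ_q`): **`Top(I_q, n) ∩ π⁻¹(C) ⊆ Γ := V(z_q, u, F̃) ∪ V(z_q′, u′, F̃′)`,
and `Γ ∩ Σ_q ≅ V(Φ̄) ⊂ ℙ¹_A` is the secondary curve.**
KEY STEP (regularity ⇒ `τ ≥ 3`).  CLAIM: at every point `x ∈ Γ` over `C` (closed or not), `(z_q, u, F̃)` is part of
a regular system of
parameters of `𝒪_{Y_q,x}`.  At a CLOSED `x` over `y` (`𝔔_x = 𝔑` maximal `⊇ 𝔪_A A[w]`): `𝒪_{Y_q,x}/(z_q, u, F̃) =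
A[w]_𝔑/(φ̄₁)` is regular
of dimension `1 = 4 − 3` iff `φ̄₁ ∉ 𝔑²A[w]_𝔑 ∩ A[w] = 𝔑²` (powers of a maximal ideal are primary) iff `φ₁ ∉ N² +
𝔭R[X]` for the preimage
`N ⊂ R[X]` of `𝔑` — the LETTER `RelSimple 𝔭 𝔪_y φ₁` (resp. `φ₂` in the other branch).  At a NON-CLOSED `x ∈ Γ` over
`C` (over `η`, or the
generic point of a fibre component): `V(Φ̄) ⊂ ℙ¹_A` is PROPER over `Spec A`, so `x̄` specialises inside `V(Φ̄)` to a
closed point `x̄′`,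
which lies over `y` (closed points of a proper `A`-scheme lie over the closed point); `V(Φ̄)` is regular at `x̄′` by
the closed case, hence
at its generisation `x̄` (localisation of a regular local ring is regular, Serre); and `φ̄₁ ≠ 0` in the domain
`𝒪_{Σ_q,x}` (if `Φ̄ = 0`,
i.e. all `G_i ∈ 𝔭`, then `φ₁ ∈ 𝔭R[X] ⊆ N² + 𝔭R[X]` for the maximal `N = (𝔪_y, X) ∋ φ₁`, violating the letter), so
`𝒪_{Y_q,x}/(z_q, u, F̃) = 𝒪_{V(Φ̄), x̄}` is regular of dimension `dim 𝒪_{Y_q,x} − 3` and the claim follows.  [In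
particular the letter
forces `Φ̿ ≠ 0`: if `Φ̄ ∈ v̄·A[U]` then `φ̄₁ = v̄ψ ∈ 𝔑²` at any maximal `𝔑 ∋ v̄` containing `ψ` or, if `ψ̄` is a
non-zero constant, `φ̄₂ ∈ 𝔑²`
at `w′ = 0`; so over each closed `y` the secondary curve has FINITE fibre = the zeros of `Φ̿` on `ℙ¹_{k(y)}`.]
CONSEQUENCE.  Let `Z, U, L ∈ gr¹ 𝒪_x = 𝔪_x/𝔪_x²` be the initial forms of `z_q, u, F̃` — LINEARLY INDEPENDENT by the claim.  The
degree-`n` initial form of `f_q` at `x` is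
            `in_n(f_q) = B(Z, U) + U^{n−1}·L`,   `B(Z, U) = Zⁿ + Σ_{i ≥ 1, i + e = n} c_{i,e}(x)·ZⁱU^{e} ∈ k(x)[Z, U]`
(the tail terms `z_qⁱu^{e}·c`, `c ∈ R[w]`: either `c(x) ≠ 0` and the term contributes the MONOMIAL `c(x)ZⁱU^e` when
`i + e = n`, or
`c ∈ 𝔪_x` and the term has order `≥ n + 1`; `u^{n−1}·F̃` contributes `U^{n−1}·in₁(F̃) = U^{n−1}L`; terms with `i =
0` sit inside `F̃`).
`P := B + U^{n−1}L` is IRREDUCIBLE over `k̄`: it has degree one in `L` with coefficients `U^{n−1}` and `B` coprime (`U ∤ B` because of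
the monomial `Zⁿ`; Gauss).  An irreducible form of degree `n ≥ 2` is not a product of linear forms, so it does not
lie in `k̄[T]` for
any space `T` of linear forms of dimension `≤ 2` (a binary form splits over `k̄`): the directrix of the single form
`P` has dimension
`3` (`Z, U, L`), and the directrix of the degree-`n` initial ideal `In_n(I_q, x) ∋ P` (`ord_x I_q = n`) can only be bigger:
            **`τ(I_q, x) ≥ 3 ≥ 2` at every point of `Y_q` over `C` of order `n`** — the exit clause of `PackageExitsOver`.
The order never exceeds `n` over `C` (`in_n f_q ≠ 0` wherever `ord ≥ n`).  With (b), (c), the regularity of `Y_q`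
and `CentresOver C`
this is `PackageExitsOver I n C`.  ∎
THE HAND-OVER AT THE JUMP (what the window asks to see).  Over a closed `y′` where `Φ̿_{y′}` is squarefree, `Γ`
meets the fibre in
`deg`-many reduced points, each with `L ∈ ⟨W⟩ + ⟨Z, U⟩` — the generic exit (five `τ = 3` points for INSEP-v at `v₀ ≠
0`).  Over the core
`y` of INSEP-v the five sheets of `Γ = V(w⁵ + v̄)` RAMIFY to the single point `x₀ = (z₂, u, w, v)`, where `F̃ = w⁵ +
v + u²` has `in₁ F̃ = V`:
`in₂ f₂ = Z² + U·V`, `τ(x₀) = 3`, the directrix now containing the direction `V` OF THE CURVE ITSELF — the isolated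
point that remains
over the core after the generic package is DECIDED by the same regularity letter (NODE-g19 §3 for the charts).
SCOPE (honest): `ρ := m mod n = n − 1` only.  For `ρ = 0` (`n ∣ m`) the analogous class is FALSE as an exit law in characteristic `p = n`
(NODE-g19 §2: `n = p = 2`, `m = 4`, `Φ = u₁⁴ + u₁³u₂ + u₁²u₂² + u₁u₂³ + u₂⁴ /𝔽₂` passes the regularity letter, yet
the stage-2 point
`(z₂ = 1, u = 0, w = 1)` has `f₂ = z′² + w′³ + w′⁴`, `τ = 1`); for `1 ≤ ρ ≤ n − 2` the same tower is expected to
exit BY ORDER (empty top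
locus at stage `q`) but mixed face monomials enter the bookkeeping — NOT claimed, left to the residual.

### §Γ.2  KERNELS (0 sorry): the chart identities `binForm_lower` / `binForm_upper` (the face reproduces as `u^m·φ₁(w)` /
`u^m·φ₂(w′)`); the CORE TEST `relSimple_X_pow_add_C` — for the pure secondary form `u₁^m + a·u₂^m` the letter
`RelSimple 𝔭 𝔪 (X^m + C a)`
FOLLOWS from `a ∈ 𝔪 ∖ (𝔪² + 𝔭)` (`ā` a UNIFORMISER of `A`: the jump point), by an evaluation-at-zero argument valid
in any commutative
ring with `𝔪` maximal; the vacuous upper chart `relSimple_of_sub_one_mem`; the assembled ring-level shape certificate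
`spreadShape_pure`; and the inhabitant's presentation `represent_INSEPv` / `insepV_census` over `𝔽₂[z, v, u₁, u₂]`
(with `a = v`:
`v ∈ 𝔪 ∖ (𝔪² + 𝔭)` in `𝒪_{𝔸⁴,0}` — hand, NODE §3 — while INSEP-v³ has `a = v³ ∈ 𝔪²`: kernels `insepV3_coeff_mem_sq`
and the NEGATIVE
`not_relSimple_X_pow_add_C_of_mem_sq`: a moving coefficient in `𝔪²` makes the letter FAIL, in any commutative ring
with `M` maximal). -/

/-- **BINARY FORM of degree `m` in the two transversal curve parameters** [g19] `binForm u₁ u₂ G m = Σ_{i=0}^{m} G i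
· u₁^i · u₂^(m-i)`,
coefficients `G i ∈ R = 𝒪_{Y,y}` (NOT residue classes: the coefficient `v` of `v·u₂⁵` in INSEP-v is kept).  The
`C`-relative δ-face of
the law (Γ).  DEFINITION (NEW object). (Sources: Hironaka1967; CossartJannsenSaito2020 Ch. 8.) -/
noncomputable def binForm (u₁ u₂ : R) (G : ℕ → R) (m : ℕ) : R :=
  ∑ i ∈ Finset.range (m + 1), G i * u₁ ^ i * u₂ ^ (m - i)

end SpreadRing

end Summit.ResolutionOfSingularities.ResolutionOfSingularities.Theorems.SpreadCut
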